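import Literature.MathematicalPhysics.QuantumFieldTheory.Balaban1983to89.BlockAveragingFederbushGValued
import Literature.MathematicalPhysics.QuantumFieldTheory.Balaban1983to89.B7Eq31BCH
import Literature.Analysis.Convex.SchauderFixedPoint
import HarnessLib

/-!
# Route `UnitScaleTilt`, crux K1 child «MinimiserStabilityRegPr» (stmt-QuantumFields-19200), stub `stub_smoothLift` (G-K1a-2′) — helper P1a:
# THE FIBRE EQUATION OF BAŁABAN'S AVERAGING (0.4) ON `SU(2)` SOLVED BY BROUWER'S FIXED POINT THEOREM

Fleet seat `ym-ust-19200-p2` (gen 0).  In the private coordinate `g = U(β(c))` of (0.4) (`BlockAveragingHaarAC`, FACT (A)) the coarse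
bond variable is `Ū′(c) = exp(Σ_k |I|⁻¹ log(h_k W*))·W`, `W = pre·g·post` (`BlockAveragingEMLHaarAC.coe_fibreCore_eq`).  Prescribing
`Ū′(c) = V(c)` and writing `W = e^{−X}V(c)` turns this into the FIXED-POINT EQUATION `Σ_k w·log(D_k e^X) = X` with `D_k = h_k V(c)*`.

* §1 bookkeeping in `M₂(ℂ)`; the Lie algebra `𝔰𝔲(2)` is the tree's `(specialUnitaryLogChart (Fin 2)).lie` (`{X : X* = −X, tr X = 0}`,
  `BlockAveragingFederbushGValued`: `exp` maps it into `SU(2)`, the series logarithm maps `1/3`-small elements of `SU(2)` into it).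
* §2 **`exists_fixedPoint_meanLog`**: for `D_k ∈ SU(2)` with `‖D_k − 1‖ ≤ η`, a weight `w ≥ 0` with `m·w ≤ 1 − θ`, and
  `‖Σ_k w·log D_k‖ ≤ ρ` (`η ≤ θ/8`, `η ≤ 1/20`, `ρ ≤ θ/40`), some `X ∈ 𝔰𝔲(2)` with `‖X‖ ≤ 2ρ/θ` solves `Σ_k w·log(D_k e^X) = X`: by (31)
  of [Balaban1985Averaging] (`B7Eq31BCH.eq31_printed`, `|log(e^Y e^X) − Y − X| ≤ 2|Y||X|`) the map sends the ball of radius `2ρ/θ` of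
  `𝔰𝔲(2)` (compact, convex) continuously into itself, and the tree's Brouwer theorem
  (`Literature.Analysis.Convex.exists_fixedPoint_of_isCompact_convex`) applies.
Elementary matrix analysis; nothing of Bałaban's is asserted.  Consumer: `UnitScaleTiltSmoothLiftCorrection` (the exact-lift correction).
-/

noncomputable section

open NormedSpace Function
open scoped Matrix.Norms.L2Operator

namespace Summit.QuantumFields.YangMills.Theorems.SmoothLiftFibre

open Literature.MathematicalPhysics.QuantumFieldTheory.Balaban1983to89
open MatrixLog ExpMeanLog

/-! ## §1 Bookkeeping in `M₂(ℂ)` -/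

section Bookkeeping

/-- `𝔰𝔲(2)` (the tree's `(specialUnitaryLogChart (Fin 2)).lie`) is closed: a finite-dimensional real subspace. [folklore] -/
theorem isClosed_su2_lie : IsClosed ((specialUnitaryLogChart (Fin 2)).lie : Set (Matrix (Fin 2) (Fin 2) ℂ)) :=
  (specialUnitaryLogChart (Fin 2)).lie.closed_of_finiteDimensional

/-- The radius of the `SU(2)` chart is `min(1/3, 3/2) = 1/3`. [folklore] -/
theorem specialUnitaryLogChart_ρ_fin_two : (specialUnitaryLogChart (Fin 2)).ρ = 1 / 3 := by
  rw [specialUnitaryLogChart_ρ, Fintype.card_fin, min_eq_left]; norm_num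

end Bookkeeping

/-! ## §2 The fibre equation `Σ_k w·log(D_k e^X) = X` solved by Brouwer's fixed point theorem -/

section Fibre

variable {m : ℕ}

/-- Unitary matrices have operator norm `≤ 1`. [folklore] -/
theorem norm_coe_su2_le (D : Matrix.specialUnitaryGroup (Fin 2) ℂ) : ‖(D : Matrix (Fin 2) (Fin 2) ℂ)‖ ≤ 1 :=
  (UnitaryModel.norm_of_mem_unitaryGroup (Matrix.mem_specialUnitaryGroup_iff.1 D.2).1).le

/-- `‖D e^X − 1‖ ≤ ‖D − 1‖ + (e^{‖X‖} − 1)` for a unitary `D`. [folklore] -/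
theorem norm_mul_exp_sub_one_le (D : Matrix.specialUnitaryGroup (Fin 2) ℂ) (X : Matrix (Fin 2) (Fin 2) ℂ) :
    ‖(D : Matrix (Fin 2) (Fin 2) ℂ) * exp X - 1‖ ≤ ‖(D : Matrix (Fin 2) (Fin 2) ℂ) - 1‖ + (Real.exp ‖X‖ - 1) := by
  have h1 : (D : Matrix (Fin 2) (Fin 2) ℂ) * exp X - 1 = (D : Matrix (Fin 2) (Fin 2) ℂ) * (exp X - 1) + ((D : Matrix _ _ ℂ) - 1) := by
    noncomm_ring
  rw [h1]
  refine (norm_add_le _ _).trans ?_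
  have h2 : ‖(D : Matrix (Fin 2) (Fin 2) ℂ) * (exp X - 1)‖ ≤ Real.exp ‖X‖ - 1 :=
    (norm_mul_le _ _).trans ((mul_le_of_le_one_left (norm_nonneg _) (norm_coe_su2_le D)).trans
      (Literature.Analysis.Calculus.norm_exp_sub_one_le X))
  linarith

/-- `e^s − 1 ≤ 2s` for `0 ≤ s ≤ 1/2`. [folklore] -/
theorem exp_sub_one_le_two_mul {s : ℝ} (h0 : 0 ≤ s) (h1 : s ≤ 1 / 2) : Real.exp s - 1 ≤ 2 * s := by
  have h := Real.exp_bound_div_one_sub_of_interval h0 (by linarith)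
  have h1s : 0 < 1 - s := by linarith
  have key : 1 / (1 - s) - 1 = s / (1 - s) := by field_simp; ring
  have h2 : s / (1 - s) ≤ 2 * s := by
    rw [div_le_iff₀ h1s]; nlinarith
  linarith

/-- **THE FIBRE EQUATION OF (0.4) SOLVED BY BROUWER.**  Let `D_k ∈ SU(2)` (`k < m`) with `‖D_k − 1‖ ≤ η`, a weight `w ≥ 0` with
`m·w ≤ 1 − θ` (`θ > 0`), and `‖Σ_k w·log D_k‖ ≤ ρ`, where `η ≤ θ/8`, `η ≤ 1/20`, `ρ ≤ θ/40`.  Then some `X ∈ 𝔰𝔲(2)` with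
`‖X‖ ≤ 2ρ/θ` solves `Σ_k w·log(D_k e^X) = X`.  Proof: by (31) of [Balaban1985Averaging] (`|log(e^Y e^X) − Y − X| ≤ 2|Y||X|`),
`‖Σ_k w·log(D_k e^X)‖ ≤ ρ + (1 − θ)‖X‖ + 4η‖X‖ ≤ 2ρ/θ` on the ball `‖X‖ ≤ 2ρ/θ` of `𝔰𝔲(2)`, which is compact and convex; the map is
continuous there and `𝔰𝔲(2)`-valued, so Brouwer's theorem applies. [cite: Balaban1985Averaging, (31) p.22] -/
theorem exists_fixedPoint_meanLog (D : Fin m → Matrix.specialUnitaryGroup (Fin 2) ℂ) {w θ η ρ : ℝ} (hw : 0 ≤ w)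
    (hθ : 0 < θ) (hmw : (m : ℝ) * w ≤ 1 - θ) (hη0 : 0 ≤ η) (hDη : ∀ k, ‖(D k : Matrix (Fin 2) (Fin 2) ℂ) - 1‖ ≤ η)
    (hηθ : η ≤ θ / 8) (hη : η ≤ 1 / 20) (hρ : ‖∑ k, (w : ℂ) • mlog (D k : Matrix (Fin 2) (Fin 2) ℂ)‖ ≤ ρ) (hρθ : ρ ≤ θ / 40) :
    ∃ X ∈ (specialUnitaryLogChart (Fin 2)).lie, ‖X‖ ≤ 2 * ρ / θ ∧ ∑ k, (w : ℂ) • mlog ((D k : Matrix (Fin 2) (Fin 2) ℂ) * exp X) = X := by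
  letI : NormedAlgebra ℚ (Matrix (Fin 2) (Fin 2) ℂ) := NormedAlgebra.restrictScalars ℚ ℂ _
  have hρ0 : 0 ≤ ρ := (norm_nonneg _).trans hρ
  have hθ1 : θ ≤ 1 := by nlinarith [mul_nonneg (Nat.cast_nonneg m : (0 : ℝ) ≤ m) hw]
  -- the radius
  set r : ℝ := 2 * ρ / θ with hr_def
  have hr0 : 0 ≤ r := by positivity
  have hr : r ≤ 1 / 20 := by
    rw [hr_def, div_le_iff₀ hθ]; linarith
  have hwn : ‖(w : ℂ)‖ = w := by rw [Complex.norm_real, Real.norm_of_nonneg hw]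
  -- logarithms of the `D_k`
  have hD1 : ∀ k, ‖(D k : Matrix (Fin 2) (Fin 2) ℂ) - 1‖ < 1 := fun k => (hDη k).trans_lt (by linarith)
  have hY : ∀ k, ‖mlog (D k : Matrix (Fin 2) (Fin 2) ℂ)‖ ≤ 2 * η := fun k =>
    (norm_mlog_le_two_mul ((hDη k).trans (by linarith))).trans (by linarith [hDη k])
  have hDexp : ∀ k, (D k : Matrix (Fin 2) (Fin 2) ℂ) = exp (mlog (D k : Matrix (Fin 2) (Fin 2) ℂ)) :=
    fun k => (exp_mlog (hD1 k)).symm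
  -- the remainder of (31)
  have hR : ∀ k (X : Matrix (Fin 2) (Fin 2) ℂ), ‖X‖ ≤ r →
      ‖mlog ((D k : Matrix (Fin 2) (Fin 2) ℂ) * exp X) - mlog (D k : Matrix (Fin 2) (Fin 2) ℂ) - X‖ ≤ 4 * η * ‖X‖ := by
    intro k X hX
    have h1 : ‖mlog (D k : Matrix (Fin 2) (Fin 2) ℂ)‖ ≤ 1 / 10 := (hY k).trans (by linarith)
    have h2 : ‖X‖ ≤ 1 / 10 := hX.trans (by linarith)
    have h := B7Eq31BCH.eq31_printed h1 h2
    rw [← hDexp k] at h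
    calc _ ≤ 2 * ‖mlog (D k : Matrix (Fin 2) (Fin 2) ℂ)‖ * ‖X‖ := h
      _ ≤ 2 * (2 * η) * ‖X‖ := by gcongr; exact hY k
      _ = 4 * η * ‖X‖ := by ring
  -- smallness of `D_k e^X`
  have hDX : ∀ k (X : Matrix (Fin 2) (Fin 2) ℂ), ‖X‖ ≤ r → ‖(D k : Matrix (Fin 2) (Fin 2) ℂ) * exp X - 1‖ ≤ 1 / 6 := by
    intro k X hX
    have h1 := norm_mul_exp_sub_one_le (D k) X
    have h2 : Real.exp ‖X‖ - 1 ≤ 2 * ‖X‖ := exp_sub_one_le_two_mul (norm_nonneg _) (by linarith)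
    linarith [hDη k]
  -- the set and the map
  set K : Set (Matrix (Fin 2) (Fin 2) ℂ) :=
    Metric.closedBall 0 r ∩ ((specialUnitaryLogChart (Fin 2)).lie : Set (Matrix (Fin 2) (Fin 2) ℂ)) with hK_def
  set Ψ : Matrix (Fin 2) (Fin 2) ℂ → Matrix (Fin 2) (Fin 2) ℂ :=
    fun X => ∑ k, (w : ℂ) • mlog ((D k : Matrix (Fin 2) (Fin 2) ℂ) * exp X) with hΨ_def
  have hmemK : ∀ {X}, X ∈ K ↔ ‖X‖ ≤ r ∧ X ∈ (specialUnitaryLogChart (Fin 2)).lie := fun {X} => by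
    rw [hK_def, Set.mem_inter_iff, Metric.mem_closedBall, dist_zero_right]; rfl
  -- (a) the ball estimate
  have hbound : ∀ X : Matrix (Fin 2) (Fin 2) ℂ, ‖X‖ ≤ r → ‖Ψ X‖ ≤ r := by
    intro X hX
    have hsplit : Ψ X = (∑ k, (w : ℂ) • mlog (D k : Matrix (Fin 2) (Fin 2) ℂ)) +
        ∑ k, (w : ℂ) • (X + (mlog ((D k : Matrix (Fin 2) (Fin 2) ℂ) * exp X) - mlog (D k : Matrix (Fin 2) (Fin 2) ℂ) - X)) := by
      rw [hΨ_def, ← Finset.sum_add_distrib]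
      refine Finset.sum_congr rfl fun k _ => ?_
      rw [← smul_add]; congr 1; abel
    have hterm : ∀ k, ‖(w : ℂ) • (X + (mlog ((D k : Matrix (Fin 2) (Fin 2) ℂ) * exp X) - mlog (D k : Matrix (Fin 2) (Fin 2) ℂ) - X))‖
        ≤ w * (r + 4 * η * r) := by
      intro k
      rw [norm_smul, hwn]
      refine mul_le_mul_of_nonneg_left ((norm_add_le _ _).trans (add_le_add hX ((hR k X hX).trans ?_))) hw
      exact mul_le_mul_of_nonneg_left hX (by positivity)
    have hsum : ‖∑ k, (w : ℂ) • (X + (mlog ((D k : Matrix (Fin 2) (Fin 2) ℂ) * exp X) - mlog (D k : Matrix (Fin 2) (Fin 2) ℂ) - X))‖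
        ≤ (m : ℝ) * w * (r + 4 * η * r) := by
      refine (norm_sum_le _ _).trans ?_
      calc ∑ k, ‖(w : ℂ) • (X + (mlog ((D k : Matrix (Fin 2) (Fin 2) ℂ) * exp X) - mlog (D k : Matrix (Fin 2) (Fin 2) ℂ) - X))‖
            ≤ ∑ _k : Fin m, w * (r + 4 * η * r) := Finset.sum_le_sum fun k _ => hterm k
        _ = (m : ℝ) * w * (r + 4 * η * r) := by rw [Finset.sum_const, Finset.card_univ, Fintype.card_fin, nsmul_eq_mul]; ring
    have hkey : ρ + (1 - θ) * (r + 4 * η * r) ≤ r := by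
      -- `ρ + (1 − θ)r + 4ηr ≤ r` iff `ρ + 4ηr ≤ θr = 2ρ` iff `8ηρ/θ ≤ ρ`
      have hθr : θ * r = 2 * ρ := by rw [hr_def]; field_simp
      have h8 : 4 * η * r ≤ ρ := by
        have : 4 * η * r = (8 * η / θ) * ρ := by rw [hr_def]; field_simp; ring
        rw [this]
        have h81 : 8 * η / θ ≤ 1 := by rw [div_le_one hθ]; linarith
        nlinarith
      nlinarith [mul_nonneg (sub_nonneg.mpr hθ1) (mul_nonneg (mul_nonneg (by norm_num : (0:ℝ) ≤ 4) hη0) hr0)]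
    rw [hsplit]
    refine (norm_add_le _ _).trans ?_
    have := mul_le_mul_of_nonneg_right hmw (show 0 ≤ r + 4 * η * r by positivity)
    linarith
  -- (b) values in `𝔰𝔲(2)`
  have hsuval : ∀ X : Matrix (Fin 2) (Fin 2) ℂ, ‖X‖ ≤ r → X ∈ (specialUnitaryLogChart (Fin 2)).lie →
      Ψ X ∈ (specialUnitaryLogChart (Fin 2)).lie := by
    intro X hX hXsu
    refine Submodule.sum_mem _ fun k _ => ?_
    have hmem : (D k : Matrix (Fin 2) (Fin 2) ℂ) * exp X ∈ (specialUnitaryLogChart (Fin 2)).carrier :=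
      (specialUnitaryLogChart (Fin 2)).mul_mem (D k).2 ((specialUnitaryLogChart (Fin 2)).exp_mem hXsu)
    have hs : ‖(D k : Matrix (Fin 2) (Fin 2) ℂ) * exp X - 1‖ ≤ (specialUnitaryLogChart (Fin 2)).ρ := by
      rw [specialUnitaryLogChart_ρ_fin_two]; exact (hDX k X hX).trans (by norm_num)
    have h := (specialUnitaryLogChart (Fin 2)).mlog_mem hmem hs
    rw [show ((w : ℂ) • mlog ((D k : Matrix (Fin 2) (Fin 2) ℂ) * exp X)) = w • mlog ((D k : Matrix (Fin 2) (Fin 2) ℂ) * exp X)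
      from Complex.coe_smul _ _]
    exact Submodule.smul_mem _ _ h
  -- (c) continuity on `K`
  have hcont : ContinuousOn Ψ K := by
    refine continuousOn_finsetSum _ fun k _ => ?_
    have hterm : ContinuousOn (fun X => mlog ((D k : Matrix (Fin 2) (Fin 2) ℂ) * exp X)) K := fun X hX => by
      have hX := (hmemK.1 hX).1
      have hlt : ‖(D k : Matrix (Fin 2) (Fin 2) ℂ) * exp X - 1‖ < 1 := (hDX k X hX).trans_lt (by norm_num)
      have hc : ContinuousAt (fun Y : Matrix (Fin 2) (Fin 2) ℂ => (D k : Matrix (Fin 2) (Fin 2) ℂ) * exp Y) X :=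
        (continuous_const.mul exp_continuous).continuousAt
      have h2 : ContinuousAt (fun Y : Matrix (Fin 2) (Fin 2) ℂ => mlog ((D k : Matrix (Fin 2) (Fin 2) ℂ) * exp Y)) X :=
        ContinuousAt.comp (f := fun Y : Matrix (Fin 2) (Fin 2) ℂ => (D k : Matrix (Fin 2) (Fin 2) ℂ) * exp Y) (g := mlog) (x := X)
          (MatrixLog.analyticAt_mlog hlt).continuousAt hc
      exact h2.continuousWithinAt
    exact hterm.const_smul (w : ℂ)
  -- (d) Brouwer
  have hKc : IsCompact K := (isCompact_closedBall (0 : Matrix (Fin 2) (Fin 2) ℂ) r).inter_right isClosed_su2_lie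
  have hKconv : Convex ℝ K := (convex_closedBall (0 : Matrix (Fin 2) (Fin 2) ℂ) r).inter (specialUnitaryLogChart (Fin 2)).lie.convex
  have hKne : K.Nonempty := ⟨0, hmemK.2 ⟨by rw [norm_zero]; exact hr0, Submodule.zero_mem _⟩⟩
  have hKE : K ⊆ ((specialUnitaryLogChart (Fin 2)).lie : Set (Matrix (Fin 2) (Fin 2) ℂ)) := Set.inter_subset_right
  have hmaps : Set.MapsTo Ψ K K := fun X hX =>
    hmemK.2 ⟨hbound X (hmemK.1 hX).1, hsuval X (hmemK.1 hX).1 (hmemK.1 hX).2⟩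
  obtain ⟨X, hXK, hfix⟩ :=
    Literature.Analysis.Convex.exists_fixedPoint_of_isCompact_convex hKc hKconv hKne (specialUnitaryLogChart (Fin 2)).lie
      hKE hcont hmaps
  exact ⟨X, (hmemK.1 hXK).2, (hmemK.1 hXK).1, hfix⟩

end Fibre

end Summit.QuantumFields.YangMills.Theorems.SmoothLiftFibre

end
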